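import Summits.Ventures.PercRepro.ReducedPendantC005

/-!
# Live reduction chains: C-005 for every instance that reduces to at most eight live edges

A **live reduction step** (`LStep`) merges a live parallel pair, contracts a live series vertex
(`IsSeriesLive`, after parking its dead edges) or kills the live edge of a live pendant vertex
(`IsPendantLive`), the series and pendant vertices being unmarked. Dead edges never block a step,
and the steps may be taken in any order. C-005 transports backwards along every step
(`C005At_of_lstep`) and hence along every chain (`C005At_of_reducesL'`); with the ≤ 8-live-edge
theorem this gives **`C005At_of_reducesL`**: C-005 at `p` for every marked network that
live-reduces to an instance with at most eight live edges — the per-instance form of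
`C005_iff_C005ReducedP` (`ReducedPendantC005.lean`), and the tool for naming further families.
-/

namespace PercRepro

namespace MultiGraph

variable {V E : Type} [DecidableEq E]

/-- **A live reduction step** of an instance `(G, p)` with marks `a, b, c, d`: a live parallel
pair merged, a live series vertex contracted (its dead edges parked first), or the live edge of a
live pendant vertex killed. -/
inductive LStep (a b c d : V) : MultiGraph V E × (E → ℝ) → MultiGraph V E × (E → ℝ) → Prop
  | parallel {G : MultiGraph V E} {p : E → ℝ} {e₁ e₂ : E} (hne : e₁ ≠ e₂)
      (hpar : G.Parallel e₁ e₂) : LStep a b c d (G, p) (G, parWeight p e₁ e₂)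
  | series {G : MultiGraph V E} {p : E → ℝ} {e₁ e₂ : E} {x y z : V}
      (hs : G.IsSeriesLive p e₁ e₂ x y z) (hx : x ≠ a ∧ x ≠ b ∧ x ≠ c ∧ x ≠ d) :
      LStep a b c d (G, p) ((G.parkDead p x y).seriesGraph e₁ y z, serWeight p e₁ e₂)
  | pendant {G : MultiGraph V E} {p : E → ℝ} {e : E} {x w : V}
      (hp : G.IsPendantLive p e x w) (hx : x ≠ a ∧ x ≠ b ∧ x ≠ c ∧ x ≠ d) :
      LStep a b c d (G, p) (G.parkDead p x w, Function.update p e 0)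

/-- **Live reduction**: the reflexive–transitive closure of the live steps. -/
def ReducesL (a b c d : V) : MultiGraph V E × (E → ℝ) → MultiGraph V E × (E → ℝ) → Prop :=
  Relation.ReflTransGen (LStep a b c d)

/-- A live step preserves probability vectors. -/
theorem LStep.isProb {a b c d : V} {x y : MultiGraph V E × (E → ℝ)} (h : LStep a b c d x y)
    (hp : IsProb x.2) : IsProb y.2 := by
  cases h with
  | parallel hne hpar => exact isProb_parWeight hp _ _
  | series hs hx => exact isProb_serWeight hp _ _
  | pendant hpe hx => exact hp.update _ ⟨le_rfl, zero_le_one⟩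

/-- A live reduction preserves probability vectors. -/
theorem ReducesL.isProb {a b c d : V} {x y : MultiGraph V E × (E → ℝ)} (h : ReducesL a b c d x y)
    (hp : IsProb x.2) : IsProb y.2 := by
  induction h with
  | refl => exact hp
  | tail _ hstep ih => exact hstep.isProb ih

variable [Fintype E]

/-- **C-005 transports backwards along a live step.** -/
theorem C005At_of_lstep {a b c d : V} {x y : MultiGraph V E × (E → ℝ)} (h : LStep a b c d x y)
    (hy : y.1.C005At y.2 a b c d) : x.1.C005At x.2 a b c d := by
  cases h with
  | parallel hne hpar => exact C005At_of_step (SPStep.parallel hne hpar) hy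
  | series hs hx => exact C005At_of_isSeriesLive hs hx hy
  | pendant hpe hx => exact C005At_of_isPendantLive hpe hx hy

/-- **C-005 transports backwards along a live reduction.** -/
theorem C005At_of_reducesL' {a b c d : V} {x y : MultiGraph V E × (E → ℝ)}
    (h : ReducesL a b c d x y) (hy : y.1.C005At y.2 a b c d) : x.1.C005At x.2 a b c d := by
  induction h using Relation.ReflTransGen.head_induction_on with
  | refl => exact hy
  | head hstep _ ih => exact C005At_of_lstep hstep ih

/-- **C-005 for every instance that live-reduces to at most eight live edges**: if `(G, p)`
reduces by live parallel, series and pendant steps away from the marks to `(G', p')` with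
`|liveEdges p'| ≤ 8`, then C-005 holds for `G` at `p` and the marks `a, b, c, d`. -/
theorem C005At_of_reducesL {a b c d : V} {G G' : MultiGraph V E} {p p' : E → ℝ} (hp : IsProb p)
    (h : ReducesL a b c d (G, p) (G', p')) (hlive : (liveEdges p').card ≤ 8) :
    G.C005At p a b c d :=
  C005At_of_reducesL' h (G'.C005At_of_card_liveEdges_le_eight (h.isProb hp) hlive a b c d)

end MultiGraph

end PercRepro
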